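import Literature.NumberTheory.EllipticCurves.TowerLocalH1CartesianProofs
import Literature.NumberTheory.EllipticCurves.ZpExtensionEisensteinDVRSettingH4AdjointProofs
import Literature.NumberTheory.EllipticCurves.ZpExtensionScalarTwistFiniteProofs
import Literature.NumberTheory.GaloisRepresentations.LocalGlobalCohomologyFiniteProofs
import Literature.NumberTheory.EllipticCurves.ZpExtensionEisensteinDVRSettingH4FbarProofs
import HarnessLib

/-!
# H.4 at the places `v ∣ p` for the curve's Eisenstein setting, XI: EXACTNESS IN THE LIMIT of the local `D`-indexed towers
# `X_j = H¹(K_v, T^{(j)})`, `Y_j = H¹(K_v, Tw T^{(j)})` — a compatible family vanishing at level `i` is `p^{i+1}` times a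
# compatible family (the input `hE` of (EXACT-REP) `Tower.exists_sub_pow_smul_forall_pairing_eq_zero`)

`Proofs` file (theorems only; no definition, no named fact, no instance, no `sorry`).

* §1 (generic presented tower of finite discrete modules over a field, x10b-p1-w7's `TowerLocalH1LiftExactProofs`)
  `Tower.exists_forall_eq_pow_smul_of_apply_eq_zero` (and `…'`, reductions given pointwise): `x` compatible, `x n = 0` ⇒
  `x = p^n • h` for a compatible `h` (w7's (E) `exists_forall_map_endo_eq_of_apply_eq_zero` with the endomorphisms `p^n •`, read
  through `H¹(n •) = n •`).
* §2 (pure tower algebra) `Tower.exists_forall_eq_pow_smul_of_apply_eq_zero_shift`: the same property for the SHIFTED tower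
  `j ↦ H (j+1)` (any one-step maps agreeing pointwise with `red (j+1)`), when `H 0` is trivial.
* §3 (generic Eisenstein tower `M_j ⊗ A_{m,j}(ψ)` = `κ.eisensteinAdicTower`, module-indexed, `AdicTower` currency)
  `ZpExtension.eisensteinAdicTower_exists_forall_eq_pow_smul_of_apply_eq_zero`.
* §4 (the curve) `eisensteinTower_exists_forall_eq_pow_smul_of_apply_eq_zero` and `…_twist`: for the `D`-indexed local towers of
  `T^{(j)} = E_K[p^{j+1}] ⊗ A_{m,j+1}(ψ)` and of `Tw T^{(j)}` at a finite place `v`, in the reduction currency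
  `ContinuousRep.cohomologyMap … (T.red j) … 1` of the cell: `δ` compatible, `δ i = 0` ⇒ `δ = p^{i+1} • ε`, `ε` compatible
  (index shift over the trivial bottom level; the twisted tower by transport from the conjugate place `σ • v`).

Cell `pub/bsd-print-x9` (STUB A `hfin4` at `v ∣ p`, (EXACT-REP-INST)).  No summit statement is proved here; BSD is not proved by any
of this.  References: [Howard2004HeegnerKolyvagin] Def. 1.1.3, §1.6, Lemma 3.2.7 (arXiv:1202.6340 p. 5, p. 12, p. 16);
[SerreGaloisCohomology1997] I §2.2; [NeukirchSchmidtWingberg2008] (1.3.3), 2.7.6.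
-/

set_option autoImplicit false

noncomputable section

open Function NumberField IsDedekindDomain Field CategoryTheory
open scoped NumberField ContRepresentation

universe u

namespace Literature.NumberTheory.EllipticCurves

namespace Tower

open Literature.NumberTheory.GaloisRepresentations

/-! ## §1 (E) in the `p^n •` currency for a presented tower -/

section Presented

variable {F : Type u} [Field F]
variable {W : ℕ → Type u} [∀ j, AddCommGroup (W j)] [∀ j, TopologicalSpace (W j)] [∀ j, DiscreteTopology (W j)]
variable (ρ : ∀ j, DiscreteGaloisModule F (W j))
variable (f : ∀ a b, (ρ a).toContRepresentation →ⁱL (ρ b).toContRepresentation)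

/-- **(E) EXACTNESS in the limit, `p^n •` form.**  For a tower of finite discrete `Γ_F`-modules presented by a two-index family
`f a b` (identities `hid`, `hcomp`, `hsq`; exact rows `hinj`, `hsurj`, `hex`; finite `H¹`'s) with `f ℓ (ℓ+n) ∘ f (ℓ+n) ℓ = p^n •`
and `p^j • W j = 0`: a compatible family `x` of `(H¹(F, W j))_j` (`red j = H¹(f (j+1) j)`) with `x n = 0` is `x = p^n • h` for a
compatible family `h` — `ker(H¹(T) → H¹(T/p^n)) = p^n H¹(T)` in the limit. [cite: Howard2004HeegnerKolyvagin, §1.6 and Lemma 3.2.7 (arXiv p. 12, p. 16)]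
[cite: SerreGaloisCohomology1997, Ch. I §2.2] -/
theorem exists_forall_eq_pow_smul_of_apply_eq_zero [∀ j, Finite (galoisCohomology (ρ j) 1)]
    (hid : ∀ a (w : W a), f a a w = w)
    (hcomp : ∀ a b c, c ≤ b → b ≤ a → ∀ w : W a, f b c (f a b w) = f a c w)
    (hsq : ∀ a b, a ≤ b → ∀ w : W (a + 1), f a b (f (a + 1) a w) = f (b + 1) b (f (a + 1) (b + 1) w))
    (hinj : ∀ ℓ n, Function.Injective (f ℓ (ℓ + n)))
    (hsurj : ∀ ℓ n, Function.Surjective (f (ℓ + n) n))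
    (hex : ∀ ℓ n (y : W (ℓ + n)), f (ℓ + n) n y = 0 ↔ ∃ x, f ℓ (ℓ + n) x = y)
    (p : ℕ) (hpow : ∀ ℓ n (w : W (ℓ + n)), f ℓ (ℓ + n) (f (ℓ + n) ℓ w) = p ^ n • w)
    (hkill : ∀ j (w : W j), p ^ j • w = 0)
    {x : Π j, galoisCohomology (ρ j) 1}
    (hx : x ∈ compatibleFamilies (H := fun j ↦ galoisCohomology (ρ j) 1) (fun j ↦ galoisCohomology.map (f (j + 1) j) 1))
    (n : ℕ) (hxn : x n = 0) :
    ∃ h ∈ compatibleFamilies (H := fun j ↦ galoisCohomology (ρ j) 1) (fun j ↦ galoisCohomology.map (f (j + 1) j) 1),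
      ∀ j, x j = p ^ n • h j := by
  obtain ⟨h, hh, hhx⟩ := exists_forall_map_endo_eq_of_apply_eq_zero ρ f hid hcomp hsq hinj hsurj hex n
    (fun j ↦ DiscreteGaloisModule.scalarIntertwining _ (DiscreteGaloisModule.isScalarLinear_int _) ((p ^ n : ℕ) : ℤ))
    (fun ℓ w ↦ by rw [DiscreteGaloisModule.scalarIntertwining_apply, natCast_zsmul, hpow ℓ n w])
    (fun j hj w ↦ by
      obtain ⟨e, he⟩ := Nat.exists_eq_add_of_le hj.le
      rw [DiscreteGaloisModule.scalarIntertwining_apply, natCast_zsmul, he, pow_add, mul_comm, mul_smul, hkill j w, smul_zero])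
    hx hxn
  exact ⟨h, hh, fun j ↦ by rw [← hhx j]; exact map_natCastIntertwining_eq_nsmul (ρ j) (p ^ n) (h j)⟩

/-- **(E) EXACTNESS in the limit, `p^n •` form, for reductions given pointwise** — the same with the tower's one-step maps
`red j` any additive maps agreeing pointwise with `H¹(f (j+1) j)` (no cast on the caller's side).
[cite: Howard2004HeegnerKolyvagin, §1.6 and Lemma 3.2.7 (arXiv p. 12, p. 16)] [cite: SerreGaloisCohomology1997, Ch. I §2.2] -/
theorem exists_forall_eq_pow_smul_of_apply_eq_zero' [∀ j, Finite (galoisCohomology (ρ j) 1)]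
    (hid : ∀ a (w : W a), f a a w = w)
    (hcomp : ∀ a b c, c ≤ b → b ≤ a → ∀ w : W a, f b c (f a b w) = f a c w)
    (hsq : ∀ a b, a ≤ b → ∀ w : W (a + 1), f a b (f (a + 1) a w) = f (b + 1) b (f (a + 1) (b + 1) w))
    (hinj : ∀ ℓ n, Function.Injective (f ℓ (ℓ + n)))
    (hsurj : ∀ ℓ n, Function.Surjective (f (ℓ + n) n))
    (hex : ∀ ℓ n (y : W (ℓ + n)), f (ℓ + n) n y = 0 ↔ ∃ x, f ℓ (ℓ + n) x = y)
    (p : ℕ) (hpow : ∀ ℓ n (w : W (ℓ + n)), f ℓ (ℓ + n) (f (ℓ + n) ℓ w) = p ^ n • w)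
    (hkill : ∀ j (w : W j), p ^ j • w = 0)
    (red : ∀ j, galoisCohomology (ρ (j + 1)) 1 →+ galoisCohomology (ρ j) 1)
    (hred : ∀ j y, red j y = galoisCohomology.map (f (j + 1) j) 1 y)
    {x : Π j, galoisCohomology (ρ j) 1}
    (hx : x ∈ compatibleFamilies (H := fun j ↦ galoisCohomology (ρ j) 1) red) (n : ℕ) (hxn : x n = 0) :
    ∃ h ∈ compatibleFamilies (H := fun j ↦ galoisCohomology (ρ j) 1) red, ∀ j, x j = p ^ n • h j := by
  obtain rfl : red = fun j ↦ galoisCohomology.map (f (j + 1) j) 1 := funext fun j ↦ AddMonoidHom.ext (hred j)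
  exact exists_forall_eq_pow_smul_of_apply_eq_zero ρ f hid hcomp hsq hinj hsurj hex p hpow hkill hx n hxn

end Presented

/-! ## §2 The shifted tower -/

/-- **(E) passes to the shifted tower `j ↦ H (j+1)` when `H 0` is trivial.**  If every compatible family `x` of `(H, red)` with
`x n = 0` is `p^n •` a compatible family, then every compatible family `δ` of the shifted tower `(j ↦ H (j+1), red′)` — `red′ j`
any additive maps agreeing pointwise with `red (j+1)` — with `δ i = 0` is `p^{i+1} • ε` for a compatible `ε` (extend `δ` by `0` in
degree `0`). [cite: Howard2004HeegnerKolyvagin, §1.6 (arXiv p. 12)] [cite: SerreGaloisCohomology1997, Ch. I §2.2] -/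
theorem exists_forall_eq_pow_smul_of_apply_eq_zero_shift {H : ℕ → Type u} [∀ j, AddCommGroup (H j)] [Subsingleton (H 0)]
    (red : ∀ j, H (j + 1) →+ H j) (p : ℕ)
    (hE : ∀ x ∈ compatibleFamilies red, ∀ n, x n = 0 → ∃ h ∈ compatibleFamilies red, ∀ j, x j = p ^ n • h j)
    (red' : ∀ j, H (j + 1 + 1) →+ H (j + 1)) (hshift : ∀ j (y : H (j + 1 + 1)), red' j y = red (j + 1) y)
    {δ : Π j, H (j + 1)} (hδ : δ ∈ compatibleFamilies (H := fun j ↦ H (j + 1)) red') (i : ℕ) (hδi : δ i = 0) :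
    ∃ ε ∈ compatibleFamilies (H := fun j ↦ H (j + 1)) red', ∀ j, δ j = p ^ (i + 1) • ε j := by
  let x : Π j, H j := fun j ↦ match j with
    | 0 => 0
    | j + 1 => δ j
  have hx : x ∈ compatibleFamilies red := by
    rw [mem_compatibleFamilies_iff]
    intro j
    cases j with
    | zero => exact Subsingleton.elim _ _
    | succ j =>
      change red (j + 1) (δ (j + 1)) = δ j
      rw [← hshift]
      exact (mem_compatibleFamilies_iff (H := fun j ↦ H (j + 1)) red' δ).1 hδ j
  obtain ⟨h, hh, hhx⟩ := hE x hx (i + 1) hδi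
  refine ⟨fun j ↦ h (j + 1), (mem_compatibleFamilies_iff (H := fun j ↦ H (j + 1)) red' _).2 fun j ↦ ?_, fun j ↦ hhx (j + 1)⟩
  rw [hshift]
  exact (mem_compatibleFamilies_iff red h).1 hh (j + 1)

end Tower

end Literature.NumberTheory.EllipticCurves

/-! ## §3 The Eisenstein tower `M_j ⊗ A_{m,j}(ψ)` (module-indexed, `AdicTower` currency) at a finite place -/

namespace Literature.NumberTheory.EllipticCurves.ZpExtension

open Literature.NumberTheory.GaloisRepresentations IwasawaAlgebra
open Literature.NumberTheory.GaloisCohomology.Howard2004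

variable {K : Type} [Field K] [NumberField K] {p : ℕ} [hp : Fact p.Prime] (κ : ZpExtension K p)
  {M : ℕ → Type} [∀ k, AddCommGroup (M k)] [∀ k, TopologicalSpace (M k)] [∀ k, DiscreteTopology (M k)]
  [∀ k, Finite (M k)]
  (ρ : ∀ k, DiscreteGaloisModule K (M k))
  (t : ∀ k, (ρ (k + 1)).toContRepresentation →ⁱL (ρ k).toContRepresentation) {m : ℕ} (hm : 1 ≤ m)

/-- **(E) for the local Eisenstein tower `(H¹(K_v, M_j ⊗ A_{m,j}(ψ)))_j` of `κ.eisensteinAdicTower`** (reductions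
`H¹(red_j)` as `ContinuousRep.cohomologyMap`; generic tower data `ht`, `hkt`, `hkill` and coordinates `M_k ≃ (ℤ/p^k)^{ι_k}`):
a compatible family vanishing at level `n` is `p^n •` a compatible family. [cite: Howard2004HeegnerKolyvagin, §1.6 and Lemma 3.2.7 (arXiv p. 12, p. 16)]
[cite: SerreGaloisCohomology1997, Ch. I §2.2] -/
theorem eisensteinAdicTower_exists_forall_eq_pow_smul_of_apply_eq_zero (ht : ∀ k, Function.Surjective (t k))
    (hkt : ∀ k (x : M (k + 1)), t k x = 0 ↔ ∃ y : M (k + 1), x = ((p : ℤ) ^ k) • y)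
    (hkill : ∀ k (x : M k), ((p : ℤ) ^ k) • x = 0) {ι : ℕ → Type} [∀ k, Fintype (ι k)]
    (e : ∀ k, M k ≃+ (ι k → ZMod (p ^ k))) (v : IsDedekindDomain.HeightOneSpectrum (𝓞 K))
    {x : Π j, letI := IwasawaAlgebra.isLocalRing_quotient_X_pow_add_C p hm
      galoisCohomology (((κ.eisensteinAdicTower ρ t hm ht).ρ j).toLocal (Sum.inr v)) 1}
    (hx : letI := IwasawaAlgebra.isLocalRing_quotient_X_pow_add_C p hm
      x ∈ Tower.compatibleFamilies
        (H := fun j ↦ galoisCohomology (((κ.eisensteinAdicTower ρ t hm ht).ρ j).toLocal (Sum.inr v)) 1)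
        (fun j ↦ ContinuousRep.cohomologyMap (((κ.eisensteinAdicTower ρ t hm ht).ρ (j + 1)).toLocal (Sum.inr v))
          (((κ.eisensteinAdicTower ρ t hm ht).ρ j).toLocal (Sum.inr v)) ((κ.eisensteinAdicTower ρ t hm ht).red j).toAddMonoidHom
          continuous_of_discreteTopology (fun _ z => (κ.eisensteinAdicTower ρ t hm ht).red_equivariant j _ z) 1))
    (n : ℕ) (hxn : x n = 0) :
    letI := IwasawaAlgebra.isLocalRing_quotient_X_pow_add_C p hm
    ∃ h ∈ Tower.compatibleFamilies
        (H := fun j ↦ galoisCohomology (((κ.eisensteinAdicTower ρ t hm ht).ρ j).toLocal (Sum.inr v)) 1)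
        (fun j ↦ ContinuousRep.cohomologyMap (((κ.eisensteinAdicTower ρ t hm ht).ρ (j + 1)).toLocal (Sum.inr v))
          (((κ.eisensteinAdicTower ρ t hm ht).ρ j).toLocal (Sum.inr v)) ((κ.eisensteinAdicTower ρ t hm ht).red j).toAddMonoidHom
          continuous_of_discreteTopology (fun _ z => (κ.eisensteinAdicTower ρ t hm ht).red_equivariant j _ z) 1),
      ∀ j, x j = p ^ n • h j := by
  letI := IwasawaAlgebra.isLocalRing_quotient_X_pow_add_C p hm
  have hfin : ∀ j, Finite (galoisCohomology (((κ.eisensteinAdicTower ρ t hm ht).ρ j).toLocal (Sum.inr v)) 1) :=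
    fun j ↦ by
      haveI : Finite (EisensteinCoeff.Twisted p m j (M j)) := EisensteinCoeff.finite_twisted hm
      haveI : Finite (EisensteinLevel p m M j) := EisensteinCoeff.finite_twisted hm
      exact finite_galoisCohomology_one_toLocal _ v
  exact @Tower.exists_forall_eq_pow_smul_of_apply_eq_zero' _ _ (EisensteinLevel p m M) _ _ _
    (fun j ↦ ((κ.eisensteinAdicTower ρ t hm ht).ρ j).toLocal (Sum.inr v))
    (fun a b ↦ DiscreteGaloisModule.localMap (κ.eisensteinTwistTransfer ρ t hm ht hkt hkill a b) (Sum.inr v)) hfin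
    (fun a w ↦ κ.eisensteinTwistTransfer_self ρ t hm ht hkt hkill a w)
    (fun a b c hcb hba w ↦ κ.eisensteinTwistTransfer_comp ρ t hm ht hkt hkill hcb hba w)
    (fun a b hab w ↦ κ.eisensteinTwistTransfer_sq ρ t hm ht hkt hkill hab w)
    (fun ℓ n ↦ κ.eisensteinTwistTransfer_injective_of_le ρ t hm ht hkt hkill e ℓ n)
    (fun ℓ n ↦ κ.eisensteinTwistTransfer_surjective_of_le ρ t hm ht hkt hkill (Nat.le_add_left n ℓ))
    (fun ℓ n y ↦ κ.eisensteinTwistTransfer_eq_zero_iff_exists ρ t hm ht hkt hkill ℓ n y) p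
    (fun ℓ n w ↦ κ.eisensteinTwistTransfer_apply_apply_of_le ρ t hm ht hkt hkill ℓ n w)
    (fun j w ↦ EisensteinCoeff.prime_pow_nsmul_twisted w) _
    (fun j y ↦ by rw [κ.eisensteinTwistTransfer_succ_self ρ t hm ht hkt hkill j]; rfl) x hx n hxn

end Literature.NumberTheory.EllipticCurves.ZpExtension

/-! ## §4 The curve's local `D`-indexed towers at a finite place -/

namespace WeierstrassCurve

open Literature.NumberTheory.EllipticCurves Literature.NumberTheory.GaloisRepresentations
open Literature.NumberTheory.GaloisRepresentations.DiscreteGaloisModule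
open Literature.NumberTheory.GaloisCohomology Literature.NumberTheory.GaloisCohomology.Howard2004
open Literature.NumberTheory.EllipticCurves.ZpExtension (EisensteinLevel)
open Literature.NumberTheory.EllipticCurves.IwasawaAlgebra

variable {K : Type} [Field K] [NumberField K] (W : WeierstrassCurve ℚ) [W.IsElliptic] {p : ℕ} [hp : Fact p.Prime]
  (κ : ZpExtension K p) {m : ℕ} (hm : 1 ≤ m)

/-- **(E) for the `D`-indexed local tower `X_j = H¹(K_v, T^{(j)})`, `T^{(j)} = E_K[p^{j+1}] ⊗ A_{m,j+1}(ψ)`** (reductions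
`H¹(T.red j)` in the cell's `ContinuousRep.cohomologyMap` currency): a compatible family `δ` with `δ i = 0` is `p^{i+1} • ε` for a
compatible family `ε` — the hypothesis `hE` of `Tower.exists_sub_pow_smul_forall_pairing_eq_zero` (index shift of §3 over the trivial
bottom level of the unshifted tower `eisensteinAdicTower`). [cite: Howard2004HeegnerKolyvagin, §1.6 and Lemma 3.2.7 (arXiv p. 12, p. 16)]
[cite: SerreGaloisCohomology1997, Ch. I §2.2] -/
theorem eisensteinTower_exists_forall_eq_pow_smul_of_apply_eq_zero (v : IsDedekindDomain.HeightOneSpectrum (𝓞 K))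
    {δ : Π j, letI := IwasawaAlgebra.isLocalRing_quotient_X_pow_add_C p hm
      galoisCohomology (((W.eisensteinTower κ hm).ρ j).toLocal (Sum.inr v)) 1}
    (hδ : letI := IwasawaAlgebra.isLocalRing_quotient_X_pow_add_C p hm
      δ ∈ Tower.compatibleFamilies (H := fun j ↦ galoisCohomology (((W.eisensteinTower κ hm).ρ j).toLocal (Sum.inr v)) 1)
        (fun j ↦ ContinuousRep.cohomologyMap (((W.eisensteinTower κ hm).ρ (j + 1)).toLocal (Sum.inr v))
          (((W.eisensteinTower κ hm).ρ j).toLocal (Sum.inr v)) ((W.eisensteinTower κ hm).red j).toAddMonoidHom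
          continuous_of_discreteTopology (fun _ z => (W.eisensteinTower κ hm).red_equivariant j _ z) 1))
    (i : ℕ) (hδi : δ i = 0) :
    letI := IwasawaAlgebra.isLocalRing_quotient_X_pow_add_C p hm
    ∃ ε ∈ Tower.compatibleFamilies (H := fun j ↦ galoisCohomology (((W.eisensteinTower κ hm).ρ j).toLocal (Sum.inr v)) 1)
        (fun j ↦ ContinuousRep.cohomologyMap (((W.eisensteinTower κ hm).ρ (j + 1)).toLocal (Sum.inr v))
          (((W.eisensteinTower κ hm).ρ j).toLocal (Sum.inr v)) ((W.eisensteinTower κ hm).red j).toAddMonoidHom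
          continuous_of_discreteTopology (fun _ z => (W.eisensteinTower κ hm).red_equivariant j _ z) 1),
      ∀ j, δ j = p ^ (i + 1) • ε j := by
  letI := IwasawaAlgebra.isLocalRing_quotient_X_pow_add_C p hm
  have hpK : (p : K) ≠ 0 := Nat.cast_ne_zero.2 hp.out.ne_zero
  haveI : ∀ k, Finite (geomTorsion (W.baseChange K) ((p : ℤ) ^ k)) := fun k ↦
    finite_torsionPoints_holds (W.baseChange K) (AlgebraicClosure K) (pow_ne_zero _ (Int.natCast_ne_zero.mpr hp.out.ne_zero))
  obtain ⟨-, hkt, hkill⟩ := (W.baseChange K).torsionGaloisModule_transition_hypotheses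
    (fun j ↦ (W.baseChange K).torsionGaloisModuleReduce p j) (W.torsionGaloisModuleReduce_coe (K := K) (p := p))
  -- the unshifted tower `A` of `E_K[p^j] ⊗ A_{m,j}(ψ)` (level `0` trivial); `T^{(j)} = A_{j+1}` definitionally
  have hA := fun (x : Π j, galoisCohomology (((κ.eisensteinAdicTower (fun j ↦ (W.baseChange K).torsionGaloisModule ((p : ℤ) ^ j))
      (fun j ↦ (W.baseChange K).torsionGaloisModuleReduce p j) hm
      (fun j ↦ (W.baseChange K).torsionGaloisModuleReduce_surjective p j)).ρ j).toLocal (Sum.inr v)) 1) hx n hxn ↦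
    κ.eisensteinAdicTower_exists_forall_eq_pow_smul_of_apply_eq_zero _ _ hm
      (fun j ↦ (W.baseChange K).torsionGaloisModuleReduce_surjective p j) hkt hkill
      (fun k ↦ ((W.baseChange K).nonempty_geomTorsion_prime_pow_addEquiv_fin_two hpK k).some) v (x := x) hx n hxn
  obtain ⟨ε, hε, hδε⟩ := @Tower.exists_forall_eq_pow_smul_of_apply_eq_zero_shift
    (fun j ↦ galoisCohomology (((κ.eisensteinAdicTower (fun j ↦ (W.baseChange K).torsionGaloisModule ((p : ℤ) ^ j))
      (fun j ↦ (W.baseChange K).torsionGaloisModuleReduce p j) hm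
      (fun j ↦ (W.baseChange K).torsionGaloisModuleReduce_surjective p j)).ρ j).toLocal (Sum.inr v)) 1) _
    (W.subsingleton_galoisCohomology_eisensteinLevel_zero κ hm (Sum.inr v : Place K)) _ p hA
    (fun j ↦ ContinuousRep.cohomologyMap
      (((κ.eisensteinAdicTower (fun j ↦ (W.baseChange K).torsionGaloisModule ((p : ℤ) ^ j))
        (fun j ↦ (W.baseChange K).torsionGaloisModuleReduce p j) hm
        (fun j ↦ (W.baseChange K).torsionGaloisModuleReduce_surjective p j)).ρ (j + 1 + 1)).toLocal (Sum.inr v))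
      (((κ.eisensteinAdicTower (fun j ↦ (W.baseChange K).torsionGaloisModule ((p : ℤ) ^ j))
        (fun j ↦ (W.baseChange K).torsionGaloisModuleReduce p j) hm
        (fun j ↦ (W.baseChange K).torsionGaloisModuleReduce_surjective p j)).ρ (j + 1)).toLocal (Sum.inr v))
      ((κ.eisensteinAdicTower (fun j ↦ (W.baseChange K).torsionGaloisModule ((p : ℤ) ^ j))
        (fun j ↦ (W.baseChange K).torsionGaloisModuleReduce p j) hm
        (fun j ↦ (W.baseChange K).torsionGaloisModuleReduce_surjective p j)).red (j + 1)).toAddMonoidHom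
      continuous_of_discreteTopology
      (fun _ z => (κ.eisensteinAdicTower (fun j ↦ (W.baseChange K).torsionGaloisModule ((p : ℤ) ^ j))
        (fun j ↦ (W.baseChange K).torsionGaloisModuleReduce p j) hm
        (fun j ↦ (W.baseChange K).torsionGaloisModuleReduce_surjective p j)).red_equivariant (j + 1) _ z) 1)
    (fun _ _ ↦ rfl) δ hδ i hδi
  exact ⟨ε, hε, hδε⟩

/-- **(E) for the TWISTED `D`-indexed local tower `Y_j = H¹(K_v, Tw T^{(j)})`**: a compatible family `η` with `η i = 0` is
`p^{i+1} • ε` for a compatible family `ε` — by TRANSPORT of the untwisted statement at the conjugate place `σ • v` along the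
bijections `cd.transportH1 : H¹(K_{σv}, T^{(j)}) ≅ H¹(K_v, Tw T^{(j)})`, natural in the reductions.
[cite: Howard2004HeegnerKolyvagin, §1.3 (Tw, arXiv p. 7 L44–48), §1.6 and Lemma 3.2.7 (p. 12, p. 16)] [cite: SerreGaloisCohomology1997, Ch. I §2.2 and §2.4] -/
theorem eisensteinTower_exists_forall_eq_pow_smul_of_apply_eq_zero_twist (cd : ConjugationDatum K)
    (v : IsDedekindDomain.HeightOneSpectrum (𝓞 K))
    {η : Π j, letI := IwasawaAlgebra.isLocalRing_quotient_X_pow_add_C p hm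
      galoisCohomology ((cd.twist ((W.eisensteinTower κ hm).ρ j)).toLocal (Sum.inr v)) 1}
    (hη : letI := IwasawaAlgebra.isLocalRing_quotient_X_pow_add_C p hm
      η ∈ Tower.compatibleFamilies (H := fun j ↦ galoisCohomology ((cd.twist ((W.eisensteinTower κ hm).ρ j)).toLocal (Sum.inr v)) 1)
        (fun j ↦ ContinuousRep.cohomologyMap ((cd.twist ((W.eisensteinTower κ hm).ρ (j + 1))).toLocal (Sum.inr v))
          ((cd.twist ((W.eisensteinTower κ hm).ρ j)).toLocal (Sum.inr v)) ((W.eisensteinTower κ hm).red j).toAddMonoidHom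
          continuous_of_discreteTopology (fun _ z => (W.eisensteinTower κ hm).red_equivariant j _ z) 1))
    (i : ℕ) (hηi : η i = 0) :
    letI := IwasawaAlgebra.isLocalRing_quotient_X_pow_add_C p hm
    ∃ ε ∈ Tower.compatibleFamilies (H := fun j ↦ galoisCohomology ((cd.twist ((W.eisensteinTower κ hm).ρ j)).toLocal (Sum.inr v)) 1)
        (fun j ↦ ContinuousRep.cohomologyMap ((cd.twist ((W.eisensteinTower κ hm).ρ (j + 1))).toLocal (Sum.inr v))
          ((cd.twist ((W.eisensteinTower κ hm).ρ j)).toLocal (Sum.inr v)) ((W.eisensteinTower κ hm).red j).toAddMonoidHom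
          continuous_of_discreteTopology (fun _ z => (W.eisensteinTower κ hm).red_equivariant j _ z) 1),
      ∀ j, η j = p ^ (i + 1) • ε j := by
  letI := IwasawaAlgebra.isLocalRing_quotient_X_pow_add_C p hm
  -- the transport bijections `τ_j : H¹(K_{σ v}, T^{(j)}) ≅ H¹(K_v, Tw T^{(j)})` and their naturality in the reductions
  have hnat : ∀ (j : ℕ) (z : galoisCohomology (((W.eisensteinTower κ hm).ρ (j + 1)).toLocal (Sum.inr (cd.σ • v))) 1),
      cd.transportH1 ((W.eisensteinTower κ hm).ρ j) v
          (ContinuousRep.cohomologyMap (((W.eisensteinTower κ hm).ρ (j + 1)).toLocal (Sum.inr (cd.σ • v)))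
            (((W.eisensteinTower κ hm).ρ j).toLocal (Sum.inr (cd.σ • v))) ((W.eisensteinTower κ hm).red j).toAddMonoidHom
            continuous_of_discreteTopology (fun _ z => (W.eisensteinTower κ hm).red_equivariant j _ z) 1 z) =
        ContinuousRep.cohomologyMap ((cd.twist ((W.eisensteinTower κ hm).ρ (j + 1))).toLocal (Sum.inr v))
          ((cd.twist ((W.eisensteinTower κ hm).ρ j)).toLocal (Sum.inr v)) ((W.eisensteinTower κ hm).red j).toAddMonoidHom
          continuous_of_discreteTopology (fun _ z => (W.eisensteinTower κ hm).red_equivariant j _ z) 1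
          (cd.transportH1 ((W.eisensteinTower κ hm).ρ (j + 1)) v z) := fun j z ↦
    cd.transportH1_map_localMap ((W.eisensteinTower κ hm).ρ (j + 1)) ((W.eisensteinTower κ hm).ρ j)
      (ZpExtension.eisensteinTwistReduce κ hm (Nat.le_succ (j + 1)) ((W.baseChange K).torsionGaloisModuleReduce p (j + 1))) v z
  -- pull `η` back to `σ • v`
  choose ζ hζ using fun j ↦ cd.transportH1_surjective ((W.eisensteinTower κ hm).ρ j) v (η j)
  have hζc : ζ ∈ Tower.compatibleFamilies
      (H := fun j ↦ galoisCohomology (((W.eisensteinTower κ hm).ρ j).toLocal (Sum.inr (cd.σ • v))) 1)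
      (fun j ↦ ContinuousRep.cohomologyMap (((W.eisensteinTower κ hm).ρ (j + 1)).toLocal (Sum.inr (cd.σ • v)))
        (((W.eisensteinTower κ hm).ρ j).toLocal (Sum.inr (cd.σ • v))) ((W.eisensteinTower κ hm).red j).toAddMonoidHom
        continuous_of_discreteTopology (fun _ z => (W.eisensteinTower κ hm).red_equivariant j _ z) 1) := by
    refine (Tower.mem_compatibleFamilies_iff _ ζ).2 fun j ↦ cd.transportH1_injective ((W.eisensteinTower κ hm).ρ j) v ?_
    refine (hnat j (ζ (j + 1))).trans ?_
    rw [hζ, hζ]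
    exact (Tower.mem_compatibleFamilies_iff _ η).1 hη j
  have hζi : ζ i = 0 := cd.transportH1_injective ((W.eisensteinTower κ hm).ρ i) v (by rw [hζ, hηi, map_zero])
  obtain ⟨ε', hε'c, hε'⟩ := W.eisensteinTower_exists_forall_eq_pow_smul_of_apply_eq_zero κ hm (cd.σ • v) hζc i hζi
  refine ⟨fun j ↦ cd.transportH1 ((W.eisensteinTower κ hm).ρ j) v (ε' j),
    (Tower.mem_compatibleFamilies_iff _ _).2 fun j ↦ ?_, fun j ↦ ?_⟩
  · exact (hnat j (ε' (j + 1))).symm.trans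
      (congrArg (cd.transportH1 ((W.eisensteinTower κ hm).ρ j) v) ((Tower.mem_compatibleFamilies_iff _ ε').1 hε'c j))
  · rw [← hζ j, hε' j, map_nsmul]

end WeierstrassCurve

end
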